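import Summits.QuantumFields.YangMills.Theorems.BalabanUVNodesN15CovariantLandauTwoGridOmegaV
import Summits.QuantumFields.YangMills.Theorems.BalabanUVNodesN15CovariantLandauTwoGridOscLetters
import Summits.QuantumFields.YangMills.Theorems.BalabanUVNodesN15CovariantLandauLetterExpLeibniz
import HarnessLib

/-!
# Route «BalabanUVNodes», node N15 = NE2, road (c) — PROGRAMME (P-S), XLVIII: THE OSCILLATION LETTERS OF n15-c∕242∕254 FOR THE KNIT's EXPONENTIAL DATA, AT THE η-RATE `n⁻¹` — `ω_N, ω_Ñ, ω_V, ω_m ≤ K·n⁻¹`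
# with `K` index-free, from (3.35)'s three members (dag-n15-c g25, n15-c∕255)

Cell `pub-ymgap`, seat `pub-ymgap-dag-n15-c` (generation g25; R134 (a), s1; HUMAN RULING D-0062; chair R424 venue).  `bears_on: R4∕N15 · K3⁸ SpineGivenEndpointR13SepCoPHV
(stmt-QuantumFields-27366)`; filed `--supports stmt-QuantumFields-27366 --as helper` — COUNT-NEUTRAL.  Theorems only; 0 `sorry`.  Imports BY NAME n15-c∕247 (`omegaN_rows_le∕_cols_le`), 248
(`omegaV_rows_le∕_cols_le`), 246 (`omegaN_transpose_le`, `omega_m_le`), 226∕232 (`tLetter_lip_rows∕_cols`), 218 (`tLetter_rows`, `tLetter_nrho`), 233a (`norm_gavgM_sub_shift_le`).  Nothing in the tree is modified.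

WHY.  n15-c∕254 displays the oscillation letters `ω_N` (rows, columns, transposed-shifted), `ω_Vt, ω_V`, `ω_m` of the pair (`T = cvT₀ e e^{Ā/n}`, `T′ = cvT₀ e e^{A′/n′}`) as free reals.
For the knit's data they are theorems of (3.35) (n15-c∕246–248); THIS FILE evaluates them at the sizes `‖A′‖ ≤ r ≤ 1`, unit steps `≤ r/n′`, fine-gradient steps `≤ r/n′` and bounds
each by an INDEX-FREE constant times `n⁻¹` (`(L^m − 1)/n′ ≤ 1/n`, `1/n′ ≤ 1/n`, `e^{r/n} ≤ 3`, `n(e^{r/n} − 1) ≤ 2r`): the η-rate of the node's two-grid defect row.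
* §1 `omegaN_transpose_cols_le` (the column twin of n15-c∕246), `rows_transpose_shift_le`, `cols_transpose_shift_le` (letters of `Ñ_μ(z) = N_μ(z − e_μ)ᵀ`);
* §2 ★★★ **`oscLetters_exp`**: the six hypotheses `hωNr hωNc hωNt hωVt hωV hωm` of n15-c∕242∕254 for the knit's data with `ω_N := K_N·n⁻¹`, `ω_V := K_V·n⁻¹`, `ω_m := K_m·n⁻¹`.

HONEST FRAMING ∕ LIMITS.  Real-arithmetic bookkeeping over n15-c∕246–248; MODEL transporters; NOT [Balaban1985BackgroundPropagators] Lemma 3.3 ∕ Thm 3.14 as printed; NE2⁺ NOT PRINTED; N15 of record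
untouched (DISCHARGED AS CONSUMED, p687738); counts UNMOVED (typed 28∕28 · discharged 8∕27); one finite 𝕋⁴ at fixed ε per index — NOT infinite volume ∕ OS ∕ mass gap ∕ Clay.  Restate-immune.
-/

noncomputable section

open scoped BigOperators Matrix
open Finset

namespace Summit.QuantumFields.YangMills.BalabanUVNodes.N15.Gluing

open Literature.MathematicalPhysics.QuantumFieldTheory.Balaban1983to89
open Literature.MathematicalPhysics.QuantumFieldTheory.Balaban1983to89.B5Prop11Plancherel (Tor fine unitVec)
open Summit.QuantumFields.YangMills.BalabanUVNodes.N15.MatrixSpecies (basisConst basisConst_nonneg norm_blockAvgV_le exp_le_three_of_le_one)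
open Summit.QuantumFields.YangMills.BalabanUVNodes.N15.BackgroundLayer (gavgM rowSum_add_le)
open Summit.QuantumFields.YangMills.BalabanUVNodes.N15.VectorPiece (kingPr kingPrV bshiftEquiv kingPr_sub_unitVec)
open Summit.QuantumFields.YangMills.BalabanUVNodes.N15.CovLandau (bDiv omegaN_transpose_le omega_m_le)

variable {d : ℕ} {L : ℕ} [NeZero L]

/-! ## §1 The column twin of n15-c∕246 and the letters of `Ñ` -/

section Cols

variable (M : Fin (d + 1) → ℕ) [∀ μ, NeZero (M μ)] (k m : ℕ) {ι : Type} [Fintype ι] [DecidableEq ι]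

/-- ★ **`ω_Ñᶜ ≤ ω_Nʳ + n·λʳ`**: the columns of `Ñ′_μ(x′) − Ñ_μ(pr x′)` (`Ñ_μ(z) = N_μ(z − e_μ)ᵀ`) from the ROWS of `N′ − N∘pr` at `x′ − e′_μ` and the row-Lipschitz letter of `T` (King's pairing dichotomy).
[cite: King1986, p.664 (pairing convention); Balaban1985BackgroundPropagators, (3.35) p.396, Thm 3.14 pp.426–427 (shapes)] -/
theorem omegaN_transpose_cols_le (T : Fin (d + 1) → Tor (fine (L ^ k) M) → Matrix ι ι ℝ) (T' : Fin (d + 1) → Tor (fine (L ^ m * L ^ k) M) → Matrix ι ι ℝ) {ωN lamr : ℝ} (hlam0 : 0 ≤ lamr)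
    (hωNr : ∀ ν x' i, ∑ j, |((fun ν x => (((L ^ m * L ^ k : ℕ) : ℝ)) • ((1 : Matrix ι ι ℝ) - T' ν x)) ν x' - (fun ν x => (((L ^ k : ℕ) : ℝ)) • ((1 : Matrix ι ι ℝ) - T ν x)) ν (kingPr L k m M x')) i j| ≤ ωN)
    (hlamr : ∀ μ (z : Tor (fine (L ^ k) M)) i, ∑ j, |(T μ z - T μ (z - unitVec (fine (L ^ k) M) μ)) i j| ≤ lamr) (μ : Fin (d + 1)) (x' : Tor (fine (L ^ m * L ^ k) M)) (i : ι) :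
    ∑ j, |((fun μ z => (((((L ^ m * L ^ k : ℕ) : ℝ)) • ((1 : Matrix ι ι ℝ) - T' μ (z - unitVec (fine (L ^ m * L ^ k) M) μ)))ᵀ)) μ x' - (fun μ z => (((((L ^ k : ℕ) : ℝ)) • ((1 : Matrix ι ι ℝ) - T μ (z - unitVec (fine (L ^ k) M) μ)))ᵀ)) μ (kingPr L k m M x')) j i| ≤ ωN + (((L ^ k : ℕ) : ℝ)) * lamr := by
  have hR : (0 : ℝ) ≤ (((L ^ k : ℕ) : ℝ)) := Nat.cast_nonneg _
  have hsplit : ∀ j, ((fun μ z => (((((L ^ m * L ^ k : ℕ) : ℝ)) • ((1 : Matrix ι ι ℝ) - T' μ (z - unitVec (fine (L ^ m * L ^ k) M) μ)))ᵀ)) μ x' - (fun μ z => (((((L ^ k : ℕ) : ℝ)) • ((1 : Matrix ι ι ℝ) - T μ (z - unitVec (fine (L ^ k) M) μ)))ᵀ)) μ (kingPr L k m M x')) j i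
      = (((fun ν x => (((L ^ m * L ^ k : ℕ) : ℝ)) • ((1 : Matrix ι ι ℝ) - T' ν x)) μ (x' - unitVec (fine (L ^ m * L ^ k) M) μ) - (fun ν x => (((L ^ k : ℕ) : ℝ)) • ((1 : Matrix ι ι ℝ) - T ν x)) μ (kingPr L k m M (x' - unitVec (fine (L ^ m * L ^ k) M) μ)))
        + ((fun ν x => (((L ^ k : ℕ) : ℝ)) • ((1 : Matrix ι ι ℝ) - T ν x)) μ (kingPr L k m M (x' - unitVec (fine (L ^ m * L ^ k) M) μ)) - (fun ν x => (((L ^ k : ℕ) : ℝ)) • ((1 : Matrix ι ι ℝ) - T ν x)) μ (kingPr L k m M x' - unitVec (fine (L ^ k) M) μ))) i j := by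
    intro j
    simp only [Matrix.sub_apply, Matrix.transpose_apply, Matrix.add_apply]
    ring
  simp_rw [hsplit]
  refine (rowSum_add_le _ _ i).trans (add_le_add (hωNr μ (x' - unitVec (fine (L ^ m * L ^ k) M) μ) i) ?_)
  rcases kingPr_sub_unitVec M L k m x' μ with h | h
  · rw [h]
    have hT : (fun ν x => (((L ^ k : ℕ) : ℝ)) • ((1 : Matrix ι ι ℝ) - T ν x)) μ (kingPr L k m M x') - (fun ν x => (((L ^ k : ℕ) : ℝ)) • ((1 : Matrix ι ι ℝ) - T ν x)) μ (kingPr L k m M x' - unitVec (fine (L ^ k) M) μ)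
        = -((((L ^ k : ℕ) : ℝ)) • (T μ (kingPr L k m M x') - T μ (kingPr L k m M x' - unitVec (fine (L ^ k) M) μ))) := by
      simp only [smul_sub]
      abel
    rw [hT]
    calc ∑ j, |(-((((L ^ k : ℕ) : ℝ)) • (T μ (kingPr L k m M x') - T μ (kingPr L k m M x' - unitVec (fine (L ^ k) M) μ)))) i j|
        = (((L ^ k : ℕ) : ℝ)) * ∑ j, |(T μ (kingPr L k m M x') - T μ (kingPr L k m M x' - unitVec (fine (L ^ k) M) μ)) i j| := by
          rw [Finset.mul_sum]
          exact Finset.sum_congr rfl fun j _ => by rw [Matrix.neg_apply, abs_neg, Matrix.smul_apply, smul_eq_mul, abs_mul, abs_of_nonneg hR]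
      _ ≤ (((L ^ k : ℕ) : ℝ)) * lamr := mul_le_mul_of_nonneg_left (hlamr μ _ i) hR
  · rw [h, sub_self]
    simp only [Matrix.zero_apply, abs_zero, Finset.sum_const_zero]
    exact mul_nonneg hR hlam0

omit [∀ μ, NeZero (M μ)] in
/-- rows of `Ñ_μ(z) = N_μ(z − e_μ)ᵀ` are columns of `N = n(1 − T)`: `≤ n·ρ` from the column letter of `T − 1`. [folklore] -/
theorem rows_transpose_shift_le (nn : ℕ) [NeZero nn] (T : Fin (d + 1) → Tor (fine nn M) → Matrix ι ι ℝ) {ρ : ℝ}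
    (hρc : ∀ ν x j, ∑ i, |(T ν x - (fun (_ : Fin (d + 1)) (_ : Tor (fine nn M)) => (1 : Matrix ι ι ℝ)) ν x) i j| ≤ ρ) (μ : Fin (d + 1)) (z : Tor (fine nn M)) (i : ι) :
    ∑ j, |(fun μ z => ((((nn : ℕ) : ℝ) • ((1 : Matrix ι ι ℝ) - T μ (z - unitVec (fine nn M) μ)))ᵀ)) μ z i j| ≤ ((nn : ℕ) : ℝ) * ρ := by
  have hR : (0 : ℝ) ≤ ((nn : ℕ) : ℝ) := Nat.cast_nonneg _
  calc _ = ((nn : ℕ) : ℝ) * ∑ j, |(T μ (z - unitVec (fine nn M) μ) - (fun (_ : Fin (d + 1)) (_ : Tor (fine nn M)) => (1 : Matrix ι ι ℝ)) μ (z - unitVec (fine nn M) μ)) j i| := by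
        rw [Finset.mul_sum]; refine Finset.sum_congr rfl fun j _ => ?_
        simp only [Matrix.transpose_apply, Matrix.smul_apply, smul_eq_mul, abs_mul, abs_of_nonneg hR, Matrix.sub_apply]
        congr 1
        exact abs_sub_comm _ _
    _ ≤ ((nn : ℕ) : ℝ) * ρ := mul_le_mul_of_nonneg_left (hρc μ _ i) hR

omit [∀ μ, NeZero (M μ)] in
/-- columns of `Ñ_μ` are rows of `N`: `≤ n·ρ` from the row letter of `T − 1`. [folklore] -/
theorem cols_transpose_shift_le (nn : ℕ) [NeZero nn] (T : Fin (d + 1) → Tor (fine nn M) → Matrix ι ι ℝ) {ρ : ℝ}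
    (hρr : ∀ ν x i, ∑ j, |(T ν x - (fun (_ : Fin (d + 1)) (_ : Tor (fine nn M)) => (1 : Matrix ι ι ℝ)) ν x) i j| ≤ ρ) (μ : Fin (d + 1)) (z : Tor (fine nn M)) (i : ι) :
    ∑ j, |(fun μ z => ((((nn : ℕ) : ℝ) • ((1 : Matrix ι ι ℝ) - T μ (z - unitVec (fine nn M) μ)))ᵀ)) μ z j i| ≤ ((nn : ℕ) : ℝ) * ρ := by
  have hR : (0 : ℝ) ≤ ((nn : ℕ) : ℝ) := Nat.cast_nonneg _
  calc _ = ((nn : ℕ) : ℝ) * ∑ j, |(T μ (z - unitVec (fine nn M) μ) - (fun (_ : Fin (d + 1)) (_ : Tor (fine nn M)) => (1 : Matrix ι ι ℝ)) μ (z - unitVec (fine nn M) μ)) i j| := by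
        rw [Finset.mul_sum]; refine Finset.sum_congr rfl fun j _ => ?_
        simp only [Matrix.transpose_apply, Matrix.smul_apply, smul_eq_mul, abs_mul, abs_of_nonneg hR, Matrix.sub_apply]
        congr 1
        exact abs_sub_comm _ _
    _ ≤ ((nn : ℕ) : ℝ) * ρ := mul_le_mul_of_nonneg_left (hρr μ _ i) hR

end Cols

/-! ## §2 The knit's exponential data: all oscillation letters `≤ K·n⁻¹` -/

section Exp

open scoped Matrix.Norms.L2Operator

variable (M : Fin (d + 1) → ℕ) [∀ μ, NeZero (M μ)] (k m : ℕ) {ι : Type} [Fintype ι] [DecidableEq ι]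
  {mm : Type} [Fintype mm] [DecidableEq mm] (e : Matrix mm mm ℂ ≃L[ℝ] (ι → ℝ))

set_option maxHeartbeats 1600000 in
/-- ★★★ **THE OSCILLATION LETTERS OF THE KNIT's DATA AT THE η-RATE**: for `A′` skew with `‖A′‖ ≤ r ≤ 1`, unit steps `≤ r/n′` and fine-gradient unit steps `≤ r/n′` ((3.35)'s members), the six
oscillation hypotheses of n15-c∕242∕254 hold for `T = cvT₀ e e^{Ā/n}`, `T′ = cvT₀ e e^{A′/n′}` with `ω_N = K_N·n⁻¹`, `ω_V = K_V·n⁻¹`, `ω_m = K_m·n⁻¹`, `K_N = |ι|κ_e(4(d+1)+16) + 3|ι|κ_m`,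
`K_V = |ι|κ_e(d+1)(2(2d+3)+32)`, `K_m = (d+1)·2·K_N·2|ι|κ_m` (index-free).
[cite: Balaban1985BackgroundPropagators, (3.35)–(3.37) p.396, Thm 3.14 pp.426–427 (the η-rate: shape); King1986, p.664, Prop. 3.9 (3.73) p.665 (shape)] -/
theorem oscLetters_exp {A' : Fin (d + 1) → Tor (fine (L ^ m * L ^ k) M) × Fin (d + 1) → Matrix mm mm ℂ} (hAs : ∀ μ p, (A' μ p)ᴴ = -A' μ p) {r : ℝ} (hr0 : 0 ≤ r) (hr1 : r ≤ 1)
    (hA : ∀ μ p, ‖A' μ p‖ ≤ r) (hstep : ∀ μ κ b', ‖A' μ (bshiftEquiv M (L ^ m * L ^ k) κ b') - A' μ b'‖ ≤ r * (((((L ^ m * L ^ k : ℕ) : ℝ)))⁻¹))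
    (hstep2 : ∀ μ κ (b' : Tor (fine (L ^ m * L ^ k) M) × Fin (d + 1)),
      ‖(fun b : Tor (fine (L ^ m * L ^ k) M) × Fin (d + 1) => (((L ^ m * L ^ k : ℕ) : ℝ)) • (A' μ b - A' μ (b.1 - unitVec (fine (L ^ m * L ^ k) M) μ, b.2))) (bshiftEquiv M (L ^ m * L ^ k) κ b') -
        (fun b : Tor (fine (L ^ m * L ^ k) M) × Fin (d + 1) => (((L ^ m * L ^ k : ℕ) : ℝ)) • (A' μ b - A' μ (b.1 - unitVec (fine (L ^ m * L ^ k) M) μ, b.2))) b'‖ ≤ r * (((((L ^ m * L ^ k : ℕ) : ℝ)))⁻¹)) :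
    (∀ ν x' i, ∑ j, |((fun ν x => (((L ^ m * L ^ k : ℕ) : ℝ)) • ((1 : Matrix ι ι ℝ) - (cvT₀ e (fun μ p => NormedSpace.exp ((((((L ^ m * L ^ k : ℕ) : ℝ)))⁻¹) • A' μ p))) ν x)) ν x' - (fun ν x => (((L ^ k : ℕ) : ℝ)) • ((1 : Matrix ι ι ℝ) - (cvT₀ e (fun μ p => NormedSpace.exp ((((((L ^ k : ℕ) : ℝ)))⁻¹) • gavgM (Matrix mm mm ℂ) (Fin (d + 1)) (kingPrV L k m M) A' μ p))) ν x)) ν (kingPr L k m M x')) i j| ≤ (Fintype.card ι * (basisConst e * (4 * ((d : ℝ) + 1) + 16)) + 3 * (Fintype.card ι * (@basisConst ι _ (Matrix mm mm ℂ) Matrix.frobeniusNormedAddCommGroup Matrix.frobeniusNormedSpace e * (2 * Real.sqrt (Fintype.card mm)) * Real.sqrt (Fintype.card mm)))) * ((((L ^ k : ℕ) : ℝ)))⁻¹) ∧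
    (∀ ν x' i, ∑ j, |((fun ν x => (((L ^ m * L ^ k : ℕ) : ℝ)) • ((1 : Matrix ι ι ℝ) - (cvT₀ e (fun μ p => NormedSpace.exp ((((((L ^ m * L ^ k : ℕ) : ℝ)))⁻¹) • A' μ p))) ν x)) ν x' - (fun ν x => (((L ^ k : ℕ) : ℝ)) • ((1 : Matrix ι ι ℝ) - (cvT₀ e (fun μ p => NormedSpace.exp ((((((L ^ k : ℕ) : ℝ)))⁻¹) • gavgM (Matrix mm mm ℂ) (Fin (d + 1)) (kingPrV L k m M) A' μ p))) ν x)) ν (kingPr L k m M x')) j i| ≤ (Fintype.card ι * (basisConst e * (4 * ((d : ℝ) + 1) + 16)) + 3 * (Fintype.card ι * (@basisConst ι _ (Matrix mm mm ℂ) Matrix.frobeniusNormedAddCommGroup Matrix.frobeniusNormedSpace e * (2 * Real.sqrt (Fintype.card mm)) * Real.sqrt (Fintype.card mm)))) * ((((L ^ k : ℕ) : ℝ)))⁻¹) ∧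
    (∀ μ x' i, ∑ j, |((fun μ z => (((((L ^ m * L ^ k : ℕ) : ℝ)) • ((1 : Matrix ι ι ℝ) - (cvT₀ e (fun μ p => NormedSpace.exp ((((((L ^ m * L ^ k : ℕ) : ℝ)))⁻¹) • A' μ p))) μ (z - unitVec (fine (L ^ m * L ^ k) M) μ)))ᵀ)) μ x' - (fun μ z => (((((L ^ k : ℕ) : ℝ)) • ((1 : Matrix ι ι ℝ) - (cvT₀ e (fun μ p => NormedSpace.exp ((((((L ^ k : ℕ) : ℝ)))⁻¹) • gavgM (Matrix mm mm ℂ) (Fin (d + 1)) (kingPrV L k m M) A' μ p))) μ (z - unitVec (fine (L ^ k) M) μ)))ᵀ)) μ (kingPr L k m M x')) i j| ≤ (Fintype.card ι * (basisConst e * (4 * ((d : ℝ) + 1) + 16)) + 3 * (Fintype.card ι * (@basisConst ι _ (Matrix mm mm ℂ) Matrix.frobeniusNormedAddCommGroup Matrix.frobeniusNormedSpace e * (2 * Real.sqrt (Fintype.card mm)) * Real.sqrt (Fintype.card mm)))) * ((((L ^ k : ℕ) : ℝ)))⁻¹) ∧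
    (∀ x' i, ∑ j, |((fun z => (bDiv M (L ^ m * L ^ k) (fun ν x => (((L ^ m * L ^ k : ℕ) : ℝ)) • ((1 : Matrix ι ι ℝ) - (cvT₀ e (fun μ p => NormedSpace.exp ((((((L ^ m * L ^ k : ℕ) : ℝ)))⁻¹) • A' μ p))) ν x)) z)ᵀ) x' - (fun z => (bDiv M (L ^ k) (fun ν x => (((L ^ k : ℕ) : ℝ)) • ((1 : Matrix ι ι ℝ) - (cvT₀ e (fun μ p => NormedSpace.exp ((((((L ^ k : ℕ) : ℝ)))⁻¹) • gavgM (Matrix mm mm ℂ) (Fin (d + 1)) (kingPrV L k m M) A' μ p))) ν x)) z)ᵀ) (kingPr L k m M x')) i j| ≤ (Fintype.card ι * (basisConst e * (((d : ℝ) + 1) * (2 * (2 * ((d : ℝ) + 1) + 1) + 32)))) * ((((L ^ k : ℕ) : ℝ)))⁻¹) ∧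
    (∀ x' i, ∑ j, |((bDiv M (L ^ m * L ^ k) (fun ν x => (((L ^ m * L ^ k : ℕ) : ℝ)) • ((1 : Matrix ι ι ℝ) - (cvT₀ e (fun μ p => NormedSpace.exp ((((((L ^ m * L ^ k : ℕ) : ℝ)))⁻¹) • A' μ p))) ν x))) x' - (bDiv M (L ^ k) (fun ν x => (((L ^ k : ℕ) : ℝ)) • ((1 : Matrix ι ι ℝ) - (cvT₀ e (fun μ p => NormedSpace.exp ((((((L ^ k : ℕ) : ℝ)))⁻¹) • gavgM (Matrix mm mm ℂ) (Fin (d + 1)) (kingPrV L k m M) A' μ p))) ν x))) (kingPr L k m M x')) i j| ≤ (Fintype.card ι * (basisConst e * (((d : ℝ) + 1) * (2 * (2 * ((d : ℝ) + 1) + 1) + 32)))) * ((((L ^ k : ℕ) : ℝ)))⁻¹) ∧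
    (∀ x' i, ∑ j, |((fun z => ∑ μ, ((fun ν x => (((L ^ m * L ^ k : ℕ) : ℝ)) • ((1 : Matrix ι ι ℝ) - (cvT₀ e (fun μ p => NormedSpace.exp ((((((L ^ m * L ^ k : ℕ) : ℝ)))⁻¹) • A' μ p))) ν x)) μ (z - unitVec (fine (L ^ m * L ^ k) M) μ))ᵀ * (fun ν x => (((L ^ m * L ^ k : ℕ) : ℝ)) • ((1 : Matrix ι ι ℝ) - (cvT₀ e (fun μ p => NormedSpace.exp ((((((L ^ m * L ^ k : ℕ) : ℝ)))⁻¹) • A' μ p))) ν x)) μ (z - unitVec (fine (L ^ m * L ^ k) M) μ)) x' - (fun z => ∑ μ, ((fun ν x => (((L ^ k : ℕ) : ℝ)) • ((1 : Matrix ι ι ℝ) - (cvT₀ e (fun μ p => NormedSpace.exp ((((((L ^ k : ℕ) : ℝ)))⁻¹) • gavgM (Matrix mm mm ℂ) (Fin (d + 1)) (kingPrV L k m M) A' μ p))) ν x)) μ (z - unitVec (fine (L ^ k) M) μ))ᵀ * (fun ν x => (((L ^ k : ℕ) : ℝ)) • ((1 : Matrix ι ι ℝ) - (cvT₀ e (fun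 μ p => NormedSpace.exp ((((((L ^ k : ℕ) : ℝ)))⁻¹) • gavgM (Matrix mm mm ℂ) (Fin (d + 1)) (kingPrV L k m M) A' μ p))) ν x)) μ (z - unitVec (fine (L ^ k) M) μ)) (kingPr L k m M x')) i j| ≤ (((d : ℝ) + 1) * ((Fintype.card ι * (basisConst e * (4 * ((d : ℝ) + 1) + 16)) + 3 * (Fintype.card ι * (@basisConst ι _ (Matrix mm mm ℂ) Matrix.frobeniusNormedAddCommGroup Matrix.frobeniusNormedSpace e * (2 * Real.sqrt (Fintype.card mm)) * Real.sqrt (Fintype.card mm)))) * (2 * Fintype.card ι * (@basisConst ι _ (Matrix mm mm ℂ) Matrix.frobeniusNormedAddCommGroup Matrix.frobeniusNormedSpace e * (2 * Real.sqrt (Fintype.card mm)) * Real.sqrt (Fintype.card mm))) + (2 * Fintype.card ι * (@basisConst ι _ (Matrix mm mm ℂ) Matrix.frobeniusNormedAddCommGroup Matrix.frobeniusNormedSpace e * (2 * Real.sqrt (Fintype.card mm)) * Real.sqrt (Fintype.card mm))) * (Fintype.card ι * (basisConst e * (4 * ((d : ℝ) + 1) + 16)) + 3 * (Fintype.card ι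 * (@basisConst ι _ (Matrix mm mm ℂ) Matrix.frobeniusNormedAddCommGroup Matrix.frobeniusNormedSpace e * (2 * Real.sqrt (Fintype.card mm)) * Real.sqrt (Fintype.card mm)))))) * ((((L ^ k : ℕ) : ℝ)))⁻¹) := by
  -- sizes
  have hLpos : 0 < L := Nat.pos_of_ne_zero (NeZero.ne L)
  have hn0 : (0 : ℝ) < (((L ^ k : ℕ) : ℝ)) := by exact_mod_cast pow_pos hLpos k
  have hn'0 : (0 : ℝ) < (((L ^ m * L ^ k : ℕ) : ℝ)) := by exact_mod_cast Nat.mul_pos (pow_pos hLpos m) (pow_pos hLpos k)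
  have hLm0 : (0 : ℝ) < ((L ^ m : ℕ) : ℝ) := by exact_mod_cast pow_pos hLpos m
  have hn1 : (1 : ℝ) ≤ (((L ^ k : ℕ) : ℝ)) := by exact_mod_cast Nat.one_le_iff_ne_zero.mpr (pow_ne_zero _ (NeZero.ne L))
  have hLm1 : (1 : ℝ) ≤ ((L ^ m : ℕ) : ℝ) := by exact_mod_cast Nat.one_le_iff_ne_zero.mpr (pow_ne_zero _ (NeZero.ne L))
  have hR1 : (((L ^ m * L ^ k : ℕ) : ℝ)) = ((L ^ m : ℕ) : ℝ) * (((L ^ k : ℕ) : ℝ)) := by push_cast; ring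
  have hinv : (0 : ℝ) ≤ ((((L ^ k : ℕ) : ℝ)))⁻¹ := by positivity
  have hinv1 : (0 : ℝ) ≤ ((((L ^ m * L ^ k : ℕ) : ℝ)))⁻¹ := by positivity
  have hLmR1 : ((L ^ m : ℕ) : ℝ) * ((((L ^ m * L ^ k : ℕ) : ℝ)))⁻¹ = ((((L ^ k : ℕ) : ℝ)))⁻¹ := by rw [hR1, mul_inv, ← mul_assoc, mul_inv_cancel₀ hLm0.ne', one_mul]
  have hR1R : ((((L ^ m * L ^ k : ℕ) : ℝ)))⁻¹ ≤ ((((L ^ k : ℕ) : ℝ)))⁻¹ := by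
    rw [hR1, mul_inv]; exact mul_le_of_le_one_left hinv (inv_le_one_of_one_le₀ hLm1)
  have hκL := basisConst_nonneg e
  have hκF := @basisConst_nonneg ι _ (Matrix mm mm ℂ) Matrix.frobeniusNormedAddCommGroup Matrix.frobeniusNormedSpace e
  have hκm : (0 : ℝ) ≤ (@basisConst ι _ (Matrix mm mm ℂ) Matrix.frobeniusNormedAddCommGroup Matrix.frobeniusNormedSpace e * (2 * Real.sqrt (Fintype.card mm)) * Real.sqrt (Fintype.card mm)) := by positivity
  have hD0 : (0 : ℝ) ≤ ((d : ℝ) + 1) := by positivity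
  -- the coarse field `Ā`
  have hĀs : ∀ μ p, (gavgM (Matrix mm mm ℂ) (Fin (d + 1)) (kingPrV L k m M) A' μ p)ᴴ = -gavgM (Matrix mm mm ℂ) (Fin (d + 1)) (kingPrV L k m M) A' μ p :=
    fun μ p => gavgM_conjTranspose_of_skew (kingPrV L k m M) hAs μ p
  have hĀ : ∀ μ p, ‖gavgM (Matrix mm mm ℂ) (Fin (d + 1)) (kingPrV L k m M) A' μ p‖ ≤ r := fun μ p => norm_blockAvgV_le (kingPrV L k m M) hr0 (hA μ) p
  have hℓc : ∀ μ (z : Tor (fine (L ^ k) M)), ‖gavgM (Matrix mm mm ℂ) (Fin (d + 1)) (kingPrV L k m M) A' μ (z, μ) - gavgM (Matrix mm mm ℂ) (Fin (d + 1)) (kingPrV L k m M) A' μ (z - unitVec (fine (L ^ k) M) μ, μ)‖ ≤ (L ^ m : ℕ) * (r * (((((L ^ m * L ^ k : ℕ) : ℝ)))⁻¹)) :=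
    fun μ z => norm_gavgM_sub_shift_le M k m A' hstep μ μ μ z
  -- the Lipschitz letters of `T` (rows and columns): `n·λ ≤ 3|ι|κ_m·n⁻¹`
  have hlamr := tLetter_lip_rows M (L ^ k) e hĀs hĀ hℓc
  have hlamc := tLetter_lip_cols M (L ^ k) e hĀs hĀ hℓc
  have hexp : Real.exp (((((L ^ k : ℕ) : ℝ)))⁻¹ * r) ≤ 3 := exp_le_three_of_le_one (by rw [inv_mul_le_iff₀ hn0]; linarith)
  have hnlam : (((L ^ k : ℕ) : ℝ)) * (Fintype.card ι * (@basisConst ι _ (Matrix mm mm ℂ) Matrix.frobeniusNormedAddCommGroup Matrix.frobeniusNormedSpace e * (2 * Real.sqrt (Fintype.card mm)) * (Real.sqrt (Fintype.card mm) * (Real.exp (((((L ^ k : ℕ) : ℝ)))⁻¹ * r) * (((((L ^ k : ℕ) : ℝ)))⁻¹ * ((L ^ m : ℕ) * (r * (((((L ^ m * L ^ k : ℕ) : ℝ)))⁻¹)))))))) ≤ 3 * (Fintype.card ι * (@basisConst ι _ (Matrix mm mm ℂ) Matrix.frobeniusNormedAddCommGroup Matrix.frobeniusNormedSpace e * (2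 * Real.sqrt (Fintype.card mm)) * Real.sqrt (Fintype.card mm))) * ((((L ^ k : ℕ) : ℝ)))⁻¹ := by
    have e1 : (((L ^ k : ℕ) : ℝ)) * (Fintype.card ι * (@basisConst ι _ (Matrix mm mm ℂ) Matrix.frobeniusNormedAddCommGroup Matrix.frobeniusNormedSpace e * (2 * Real.sqrt (Fintype.card mm)) * (Real.sqrt (Fintype.card mm) * (Real.exp (((((L ^ k : ℕ) : ℝ)))⁻¹ * r) * (((((L ^ k : ℕ) : ℝ)))⁻¹ * ((L ^ m : ℕ) * (r * (((((L ^ m * L ^ k : ℕ) : ℝ)))⁻¹)))))))) =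
        Real.exp (((((L ^ k : ℕ) : ℝ)))⁻¹ * r) * r * (Fintype.card ι * (@basisConst ι _ (Matrix mm mm ℂ) Matrix.frobeniusNormedAddCommGroup Matrix.frobeniusNormedSpace e * (2 * Real.sqrt (Fintype.card mm)) * Real.sqrt (Fintype.card mm))) * (((L ^ m : ℕ) : ℝ) * ((((L ^ m * L ^ k : ℕ) : ℝ)))⁻¹) := by field_simp
    rw [e1, hLmR1]
    have : Real.exp (((((L ^ k : ℕ) : ℝ)))⁻¹ * r) * r ≤ 3 := by nlinarith [Real.exp_pos (((((L ^ k : ℕ) : ℝ)))⁻¹ * r)]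
    exact mul_le_mul_of_nonneg_right (mul_le_mul_of_nonneg_right this (by positivity)) hinv
  -- `ω_N` rows and columns (n15-c∕247) and the simplification of its constant
  have hωr := omegaN_rows_le M k m e hAs hr1 hA hstep
  have hωc := omegaN_cols_le M k m e hAs hr1 hA hstep
  have hω0 : Fintype.card ι * (basisConst e * (2 * ((2 * ((d + 1) * (L ^ m - 1)) : ℕ) * (r * (((((L ^ m * L ^ k : ℕ) : ℝ)))⁻¹))) + 8 * r ^ 2 * ((((((L ^ m * L ^ k : ℕ) : ℝ)))⁻¹) + (((((L ^ k : ℕ) : ℝ)))⁻¹)))) ≤ Fintype.card ι * (basisConst e * (4 * ((d : ℝ) + 1) + 16)) * ((((L ^ k : ℕ) : ℝ)))⁻¹ := by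
    have hc1 : ((2 * ((d + 1) * (L ^ m - 1)) : ℕ) : ℝ) ≤ 2 * ((d : ℝ) + 1) * ((L ^ m : ℕ) : ℝ) := by
      have hN : (2 * ((d + 1) * (L ^ m - 1)) : ℕ) ≤ 2 * ((d + 1) * L ^ m) := Nat.mul_le_mul_left _ (Nat.mul_le_mul_left _ (Nat.sub_le _ _))
      calc ((2 * ((d + 1) * (L ^ m - 1)) : ℕ) : ℝ) ≤ ((2 * ((d + 1) * L ^ m) : ℕ) : ℝ) := by exact_mod_cast hN
        _ = 2 * ((d : ℝ) + 1) * ((L ^ m : ℕ) : ℝ) := by push_cast; ring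
    have t1 : 2 * ((2 * ((d + 1) * (L ^ m - 1)) : ℕ) * (r * (((((L ^ m * L ^ k : ℕ) : ℝ)))⁻¹))) ≤ 4 * ((d : ℝ) + 1) * ((((L ^ k : ℕ) : ℝ)))⁻¹ := by
      calc 2 * ((2 * ((d + 1) * (L ^ m - 1)) : ℕ) * (r * (((((L ^ m * L ^ k : ℕ) : ℝ)))⁻¹))) ≤ 2 * ((2 * ((d : ℝ) + 1) * ((L ^ m : ℕ) : ℝ)) * (1 * (((((L ^ m * L ^ k : ℕ) : ℝ)))⁻¹))) := by gcongr
        _ = 4 * ((d : ℝ) + 1) * (((L ^ m : ℕ) : ℝ) * ((((L ^ m * L ^ k : ℕ) : ℝ)))⁻¹) := by ring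
        _ = 4 * ((d : ℝ) + 1) * ((((L ^ k : ℕ) : ℝ)))⁻¹ := by rw [hLmR1]
    have t2 : 8 * r ^ 2 * ((((((L ^ m * L ^ k : ℕ) : ℝ)))⁻¹) + (((((L ^ k : ℕ) : ℝ)))⁻¹)) ≤ 16 * ((((L ^ k : ℕ) : ℝ)))⁻¹ := by
      have hr2 : r ^ 2 ≤ 1 := by nlinarith
      nlinarith [hR1R, hinv, hinv1]
    calc _ ≤ Fintype.card ι * (basisConst e * (4 * ((d : ℝ) + 1) * ((((L ^ k : ℕ) : ℝ)))⁻¹ + 16 * ((((L ^ k : ℕ) : ℝ)))⁻¹)) := by gcongr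
      _ = Fintype.card ι * (basisConst e * (4 * ((d : ℝ) + 1) + 16)) * ((((L ^ k : ℕ) : ℝ)))⁻¹ := by ring
  have hKN : Fintype.card ι * (basisConst e * (2 * ((2 * ((d + 1) * (L ^ m - 1)) : ℕ) * (r * (((((L ^ m * L ^ k : ℕ) : ℝ)))⁻¹))) + 8 * r ^ 2 * ((((((L ^ m * L ^ k : ℕ) : ℝ)))⁻¹) + (((((L ^ k : ℕ) : ℝ)))⁻¹)))) + (((L ^ k : ℕ) : ℝ)) * (Fintype.card ι * (@basisConst ι _ (Matrix mm mm ℂ) Matrix.frobeniusNormedAddCommGroup Matrix.frobeniusNormedSpace e * (2 * Real.sqrt (Fintype.card mm)) * (Real.sqrt (Fintype.card mm) * (Real.exp (((((L ^ k : ℕ) : ℝ)))⁻¹ * r) * (((((L ^ k : ℕ) : ℝ)))⁻¹ * ((L ^ m : ℕ) * (r * (((((L ^ m * L ^ k : ℕ) : ℝ)))⁻¹)))))))) ≤ (Fintype.card ι * (basisConst e * (4 * ((d : ℝ) + 1) + 16)) + 3 * (Fintype.card ι * (@basisConst ι _ (Matrix mm mm ℂ) Matrix.frobeniusNormedAddCommGroup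 Matrix.frobeniusNormedSpace e * (2 * Real.sqrt (Fintype.card mm)) * Real.sqrt (Fintype.card mm)))) * ((((L ^ k : ℕ) : ℝ)))⁻¹ := by
    calc _ ≤ Fintype.card ι * (basisConst e * (4 * ((d : ℝ) + 1) + 16)) * ((((L ^ k : ℕ) : ℝ)))⁻¹ + 3 * (Fintype.card ι * (@basisConst ι _ (Matrix mm mm ℂ) Matrix.frobeniusNormedAddCommGroup Matrix.frobeniusNormedSpace e * (2 * Real.sqrt (Fintype.card mm)) * Real.sqrt (Fintype.card mm))) * ((((L ^ k : ℕ) : ℝ)))⁻¹ := add_le_add hω0 hnlam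
      _ = (Fintype.card ι * (basisConst e * (4 * ((d : ℝ) + 1) + 16)) + 3 * (Fintype.card ι * (@basisConst ι _ (Matrix mm mm ℂ) Matrix.frobeniusNormedAddCommGroup Matrix.frobeniusNormedSpace e * (2 * Real.sqrt (Fintype.card mm)) * Real.sqrt (Fintype.card mm)))) * ((((L ^ k : ℕ) : ℝ)))⁻¹ := by ring
  have hKN0 : Fintype.card ι * (basisConst e * (2 * ((2 * ((d + 1) * (L ^ m - 1)) : ℕ) * (r * (((((L ^ m * L ^ k : ℕ) : ℝ)))⁻¹))) + 8 * r ^ 2 * ((((((L ^ m * L ^ k : ℕ) : ℝ)))⁻¹) + (((((L ^ k : ℕ) : ℝ)))⁻¹)))) ≤ (Fintype.card ι * (basisConst e * (4 * ((d : ℝ) + 1) + 16)) + 3 * (Fintype.card ι * (@basisConst ι _ (Matrix mm mm ℂ) Matrix.frobeniusNormedAddCommGroup Matrix.frobeniusNormedSpace e * (2 * Real.sqrt (Fintype.card mm)) * Real.sqrt (Fintype.card mm)))) * ((((L ^ k : ℕ) : ℝ)))⁻¹ :=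
    le_trans (le_add_of_nonneg_right (by positivity)) hKN
  -- `ω_Ñ` rows (n15-c∕246) and columns (§1)
  have hωt := omegaN_transpose_le M L k m (cvT₀ e (fun μ p => NormedSpace.exp ((((((L ^ k : ℕ) : ℝ)))⁻¹) • gavgM (Matrix mm mm ℂ) (Fin (d + 1)) (kingPrV L k m M) A' μ p))) (cvT₀ e (fun μ p => NormedSpace.exp ((((((L ^ m * L ^ k : ℕ) : ℝ)))⁻¹) • A' μ p))) (by positivity) hωc hlamc
  have hωtc := omegaN_transpose_cols_le M k m (cvT₀ e (fun μ p => NormedSpace.exp ((((((L ^ k : ℕ) : ℝ)))⁻¹) • gavgM (Matrix mm mm ℂ) (Fin (d + 1)) (kingPrV L k m M) A' μ p))) (cvT₀ e (fun μ p => NormedSpace.exp ((((((L ^ m * L ^ k : ℕ) : ℝ)))⁻¹) • A' μ p))) (by positivity) hωr hlamr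
  -- `ω_V` (n15-c∕248)
  have hVr := omegaV_rows_le M k m e hAs hr1 hA hstep hstep2
  have hVc := omegaV_cols_le M k m e hAs hr1 hA hstep hstep2
  have hKV : Fintype.card ι * (basisConst e * (((d : ℝ) + 1) * (2 * (((2 * ((d + 1) * (L ^ m - 1)) + L ^ m : ℕ) : ℝ) * (r * (((((L ^ m * L ^ k : ℕ) : ℝ)))⁻¹))) + 16 * r * (r * (((((L ^ m * L ^ k : ℕ) : ℝ)))⁻¹) + (L ^ m : ℕ) * (r * (((((L ^ m * L ^ k : ℕ) : ℝ)))⁻¹)))))) ≤ (Fintype.card ι * (basisConst e * (((d : ℝ) + 1) * (2 * (2 * ((d : ℝ) + 1) + 1) + 32)))) * ((((L ^ k : ℕ) : ℝ)))⁻¹ := by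
    have hc1 : ((2 * ((d + 1) * (L ^ m - 1)) + L ^ m : ℕ) : ℝ) ≤ (2 * ((d : ℝ) + 1) + 1) * ((L ^ m : ℕ) : ℝ) := by
      have hN : (2 * ((d + 1) * (L ^ m - 1)) + L ^ m : ℕ) ≤ 2 * ((d + 1) * L ^ m) + L ^ m := Nat.add_le_add_right (Nat.mul_le_mul_left _ (Nat.mul_le_mul_left _ (Nat.sub_le _ _))) _
      calc ((2 * ((d + 1) * (L ^ m - 1)) + L ^ m : ℕ) : ℝ) ≤ ((2 * ((d + 1) * L ^ m) + L ^ m : ℕ) : ℝ) := by exact_mod_cast hN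
        _ = (2 * ((d : ℝ) + 1) + 1) * ((L ^ m : ℕ) : ℝ) := by push_cast; ring
    have t1 : 2 * (((2 * ((d + 1) * (L ^ m - 1)) + L ^ m : ℕ) : ℝ) * (r * (((((L ^ m * L ^ k : ℕ) : ℝ)))⁻¹))) ≤ 2 * (2 * ((d : ℝ) + 1) + 1) * ((((L ^ k : ℕ) : ℝ)))⁻¹ := by
      calc _ ≤ 2 * (((2 * ((d : ℝ) + 1) + 1) * ((L ^ m : ℕ) : ℝ)) * (1 * (((((L ^ m * L ^ k : ℕ) : ℝ)))⁻¹))) := by gcongr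
        _ = 2 * (2 * ((d : ℝ) + 1) + 1) * (((L ^ m : ℕ) : ℝ) * ((((L ^ m * L ^ k : ℕ) : ℝ)))⁻¹) := by ring
        _ = 2 * (2 * ((d : ℝ) + 1) + 1) * ((((L ^ k : ℕ) : ℝ)))⁻¹ := by rw [hLmR1]
    have t2 : 16 * r * (r * (((((L ^ m * L ^ k : ℕ) : ℝ)))⁻¹) + (L ^ m : ℕ) * (r * (((((L ^ m * L ^ k : ℕ) : ℝ)))⁻¹))) ≤ 32 * ((((L ^ k : ℕ) : ℝ)))⁻¹ := by
      have u1 : r * (((((L ^ m * L ^ k : ℕ) : ℝ)))⁻¹) ≤ ((((L ^ k : ℕ) : ℝ)))⁻¹ := (mul_le_of_le_one_left hinv1 hr1).trans hR1R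
      have u2 : (L ^ m : ℕ) * (r * (((((L ^ m * L ^ k : ℕ) : ℝ)))⁻¹)) ≤ ((((L ^ k : ℕ) : ℝ)))⁻¹ := by
        calc (L ^ m : ℕ) * (r * (((((L ^ m * L ^ k : ℕ) : ℝ)))⁻¹)) ≤ ((L ^ m : ℕ) : ℝ) * (1 * (((((L ^ m * L ^ k : ℕ) : ℝ)))⁻¹)) := by gcongr
          _ = ((((L ^ k : ℕ) : ℝ)))⁻¹ := by rw [one_mul, hLmR1]
      nlinarith [u1, u2, hinv]
    calc _ ≤ Fintype.card ι * (basisConst e * (((d : ℝ) + 1) * (2 * (2 * ((d : ℝ) + 1) + 1) * ((((L ^ k : ℕ) : ℝ)))⁻¹ + 32 * ((((L ^ k : ℕ) : ℝ)))⁻¹))) := by gcongr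
      _ = (Fintype.card ι * (basisConst e * (((d : ℝ) + 1) * (2 * (2 * ((d : ℝ) + 1) + 1) + 32)))) * ((((L ^ k : ℕ) : ℝ)))⁻¹ := by ring
  -- `ω_m` (n15-c∕246): the letters `α, α′` of `Ñ, Ñ′`
  obtain ⟨hρr, hρc⟩ := tLetter_rows M (L ^ k) e hĀs hĀ
  obtain ⟨hρr', hρc'⟩ := tLetter_rows M (L ^ m * L ^ k) e hAs hA
  have hα := rows_transpose_shift_le M (L ^ k) (cvT₀ e (fun μ p => NormedSpace.exp ((((((L ^ k : ℕ) : ℝ)))⁻¹) • gavgM (Matrix mm mm ℂ) (Fin (d + 1)) (kingPrV L k m M) A' μ p))) hρc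
  have hα' := cols_transpose_shift_le M (L ^ m * L ^ k) (cvT₀ e (fun μ p => NormedSpace.exp ((((((L ^ m * L ^ k : ℕ) : ℝ)))⁻¹) • A' μ p))) hρr'
  have hnρ : (((L ^ k : ℕ) : ℝ)) * (Fintype.card ι * (@basisConst ι _ (Matrix mm mm ℂ) Matrix.frobeniusNormedAddCommGroup Matrix.frobeniusNormedSpace e * (2 * Real.sqrt (Fintype.card mm)) * (Real.sqrt (Fintype.card mm) * (Real.exp (((((L ^ k : ℕ) : ℝ)))⁻¹ * r) - 1)))) ≤ (2 * Fintype.card ι * (@basisConst ι _ (Matrix mm mm ℂ) Matrix.frobeniusNormedAddCommGroup Matrix.frobeniusNormedSpace e * (2 * Real.sqrt (Fintype.card mm)) * Real.sqrt (Fintype.card mm))) := by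
    have h := tLetter_nrho (ι := ι) (L ^ k) hκm hr0 hr1
    calc _ = (((L ^ k : ℕ) : ℝ)) * (Fintype.card ι * ((@basisConst ι _ (Matrix mm mm ℂ) Matrix.frobeniusNormedAddCommGroup Matrix.frobeniusNormedSpace e * (2 * Real.sqrt (Fintype.card mm)) * Real.sqrt (Fintype.card mm)) * (Real.exp (((((L ^ k : ℕ) : ℝ)))⁻¹ * r) - 1))) := by ring
      _ ≤ (2 * Fintype.card ι * (@basisConst ι _ (Matrix mm mm ℂ) Matrix.frobeniusNormedAddCommGroup Matrix.frobeniusNormedSpace e * (2 * Real.sqrt (Fintype.card mm)) * Real.sqrt (Fintype.card mm))) * r := h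
      _ ≤ (2 * Fintype.card ι * (@basisConst ι _ (Matrix mm mm ℂ) Matrix.frobeniusNormedAddCommGroup Matrix.frobeniusNormedSpace e * (2 * Real.sqrt (Fintype.card mm)) * Real.sqrt (Fintype.card mm))) := mul_le_of_le_one_right (by positivity) hr1
  have hnρ' : (((L ^ m * L ^ k : ℕ) : ℝ)) * (Fintype.card ι * (@basisConst ι _ (Matrix mm mm ℂ) Matrix.frobeniusNormedAddCommGroup Matrix.frobeniusNormedSpace e * (2 * Real.sqrt (Fintype.card mm)) * (Real.sqrt (Fintype.card mm) * (Real.exp (((((L ^ m * L ^ k : ℕ) : ℝ)))⁻¹ * r) - 1)))) ≤ (2 * Fintype.card ι * (@basisConst ι _ (Matrix mm mm ℂ) Matrix.frobeniusNormedAddCommGroup Matrix.frobeniusNormedSpace e * (2 * Real.sqrt (Fintype.card mm)) * Real.sqrt (Fintype.card mm))) := by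
    have h := tLetter_nrho (ι := ι) (L ^ m * L ^ k) hκm hr0 hr1
    calc _ = (((L ^ m * L ^ k : ℕ) : ℝ)) * (Fintype.card ι * ((@basisConst ι _ (Matrix mm mm ℂ) Matrix.frobeniusNormedAddCommGroup Matrix.frobeniusNormedSpace e * (2 * Real.sqrt (Fintype.card mm)) * Real.sqrt (Fintype.card mm)) * (Real.exp (((((L ^ m * L ^ k : ℕ) : ℝ)))⁻¹ * r) - 1))) := by ring
      _ ≤ (2 * Fintype.card ι * (@basisConst ι _ (Matrix mm mm ℂ) Matrix.frobeniusNormedAddCommGroup Matrix.frobeniusNormedSpace e * (2 * Real.sqrt (Fintype.card mm)) * Real.sqrt (Fintype.card mm))) * r := h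
      _ ≤ (2 * Fintype.card ι * (@basisConst ι _ (Matrix mm mm ℂ) Matrix.frobeniusNormedAddCommGroup Matrix.frobeniusNormedSpace e * (2 * Real.sqrt (Fintype.card mm)) * Real.sqrt (Fintype.card mm))) := mul_le_of_le_one_right (by positivity) hr1
  have hωm := omega_m_le M L k m (cvT₀ e (fun μ p => NormedSpace.exp ((((((L ^ k : ℕ) : ℝ)))⁻¹) • gavgM (Matrix mm mm ℂ) (Fin (d + 1)) (kingPrV L k m M) A' μ p))) (cvT₀ e (fun μ p => NormedSpace.exp ((((((L ^ m * L ^ k : ℕ) : ℝ)))⁻¹) • A' μ p))) (fun μ x' i => (hωt μ x' i).trans hKN) (fun μ x' i => (hωtc μ x' i).trans hKN)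
    (fun μ z i => (hα μ z i).trans hnρ) (fun μ z' i => (hα' μ z' i).trans hnρ')
  refine ⟨fun ν x' i => (hωr ν x' i).trans hKN0, fun ν x' i => (hωc ν x' i).trans hKN0, fun μ x' i => (hωt μ x' i).trans hKN, fun x' i => (hVc x' i).trans hKV,
    fun x' i => (hVr x' i).trans hKV, fun x' i => (hωm x' i).trans (le_of_eq (by ring))⟩

end Exp

end Summit.QuantumFields.YangMills.BalabanUVNodes.N15.Gluing

end
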